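import Literature.NumberTheory.Automorphic.WhittakerCoeffCuspidal
import Literature.NumberTheory.Automorphic.WhittakerBesselGL2
import Literature.NumberTheory.Automorphic.SatakeParameterTrivialBound
import HarnessLib

/-!
# Factorisation of global Whittaker coefficients on `GL₂` along the unramified torus directions

Topic `NumberTheory/Automorphic`; namespace `Literature.NumberTheory.Automorphic`. A brick of the
mean-square route to Jacquet–Shalika's Theorem (5.3) for `GL₂`
(`StandardLFunctionData.multipliable_L`; files `WhittakerCoeffCuspidal`, `WhittakerBesselGL2`,
`IdelicDyadicUnfolding`). Shintani's formula for the Whittaker coefficients of a smoothed cuspidal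
vector (`whittakerCoeff_smoothedForm_ofLocal_piPowGL_eq`) computes
`W_φ(ι_v(ϖ_v^μ) g') = q_v^{-b(μ)/2} s_μ(x_v) W_φ(g')` one good place `v` at a time, for `g'` with
trivial `v`-component. The mean-square method needs the consequence along an idele: for a profile
`m : T → ℕ` on a finite set `T` of good places and `π_m = ∏_{v ∈ T} (ϖ_v^{m_v} at v)`,
`W_φ(d(π_m z, 1) h) = (∏_{v∈T} q_v^{-m_v/2} s_{m_v}(x_v)) · W_φ(d(z, 1) h)` whenever the
`v`-components of `d(z,1) h` are in `GL₂(𝒪_v)` (`v ∈ T`) — with no multiplicity-one input. This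
file proves it:

* `exists_uniformizer_whittakerCoeff_smoothedForm_piPowGL_eq` — Shintani's formula with the
  uniformizer of the Satake datum produced **before** the outer variable `g'` (same proof as in
  `WhittakerCoeffCuspidal`; general `n`);
* `GLn.stripAt v g = g ι_v(g_v)⁻¹` (trivial `v`-component) and
  `apply_ofLocal_mul_eq_of_map_adeleEval_mem_glInt` — **peeling one place**: a relation
  `W(ι_v(t) g') = c W(g')` for `g'_v = 1` extends to all `X` with `X_v ∈ GL_n(𝒪_v)` when `W` is right
  `ι_v(GL_n(𝒪_v))`-invariant (general `n`);
* `diagGL2_localUnits_one` (`d(localUnits x, 1) = ι_v(d(x,1))` for the tree's local idele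
  `GaloisRepresentations.localUnits`, via
  `heckeDiagAt_eq_ofLocal`), `piPowGL_vecCons` (`ϖ^{(m,0)} = d(ϖ^m, 1)`), `torusExponent_vecCons_zero`
  (`b((m,0)) = m`), components of local ideles and torus elements (`n = 2`);
* `profileIdele ϖ m T = ∏_{v∈T} localUnits (ϖ_v^{m_v})` and
  `whittaker_factorization_profileIdele` — **the factorisation**, by induction on `T`.

Everything is proved; folklore given Shintani's formula (Jacquet–Shalika (1981), §2 and (5.3.2);
Cogdell, *Analytic theory of L-functions for GL_n* (2004), §3, for the Euler factorisation of
Whittaker integrals, here without uniqueness of Whittaker models).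

## References

* T. Shintani, *On an explicit formula for class-1 "Whittaker functions" on GL_n over P-adic
  fields*, Proc. Japan Acad. 52 (1976) [Shintani1976].
* H. Jacquet, J. A. Shalika, *On Euler products and the classification of automorphic
  representations I*, Amer. J. Math. 103 (1981), §2, §5 [JacquetShalikaAJM1981].
-/

noncomputable section

open scoped MatrixGroups ComplexConjugate
open NumberField IsDedekindDomain MeasureTheory Matrix ValuativeRel
open Literature.RingTheory.SymmetricFunctions.SymmPoly

namespace Literature.NumberTheory.Automorphic

/-! ### Shintani's formula for smoothed cuspidal vectors, uniformly in the outer variable -/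

section Uniform

variable {n : ℕ} {K : Type} [Field K] [NumberField K]
  {μ : Measure (AdelicGroupData.gl n K).automorphicQuotient}
  [(AdelicGroupData.gl n K).IsAutomorphicMeasure μ]
  [MeasurableSpace ↥(adelicUnipotent n K)] [BorelSpace ↥(adelicUnipotent n K)]
  [MeasurableConstSMul ↥(rationalUnipotent n K) ↥(adelicUnipotent n K)]
  {ν : Measure ↥(adelicUnipotent n K)} [IsFiniteMeasureOnCompacts ν]
  [SMulInvariantMeasure ↥(rationalUnipotent n K) ↥(adelicUnipotent n K) ν] [ν.IsMulRightInvariant]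
  {𝓕 : Set ↥(adelicUnipotent n K)} {ψ : AddChar (AdeleRing (𝓞 K) K) Circle}

/-- **Shintani's formula for the Whittaker coefficients of a smoothed cuspidal vector, with the
uniformizer chosen independently of the outer variable.** Same statement and proof as
`whittakerCoeff_smoothedForm_ofLocal_piPowGL_eq` (`WhittakerCoeffCuspidal`), except that the
uniformizer `ϖ` of the Satake datum (which comes from `sum_invQuot_smoothedForm_mul_ofLocal_rep_eq`
and does not depend on `g'`) is produced *before* `g'` with `g'_v = 1` is quantified — the form
needed to factor `W_φ(d(y) h)` place by place along an idele `y`.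
[cite: Shintani1976, Theorem (p. 181)] -/
theorem exists_uniformizer_whittakerCoeff_smoothedForm_piPowGL_eq (P : CuspidalAutomorphicRepGL n K μ)
    {S : Set (HeightOneSpectrum (𝓞 K))} {α : SatakeFamily K} (hα : IsSatakeFamilyOf P S α)
    {𝔫₀ : Ideal (𝓞 K)} (h𝔫₀ : 𝔫₀ ≠ 0) {v : HeightOneSpectrum (𝓞 K)} (hvS : v ∉ S)
    (hv : ¬ v.asIdeal ∣ 𝔫₀) {η : (AdelicGroupData.gl n K).Adelic → ℝ} (hη : Continuous η)
    (hηs : HasCompactSupport η)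
    (hηK : ∀ k : (AdelicGroupData.gl n K).Adelic, k ∈ principalCongruenceLevel n K 𝔫₀ →
      ∀ g : (AdelicGroupData.gl n K).Adelic, η (k * g) = η g)
    (f : P.1.toSubmodule) {x : Fin n → ℂ} (hx : (Finset.univ : Finset (Fin n)).val.map x = α v)
    (h𝓕 : IsFundamentalDomain ↥(rationalUnipotent n K) 𝓕 ν) (h𝓕c : IsCompact (closure 𝓕))
    (hψ : IsGlobalAddChar K ψ)
    (hψv : ∀ c ∈ 𝒪[v.adicCompletion K], ψ.adicComponent v c = 1)
    (hψv' : ∀ ϖ : v.adicCompletion K, Valued.v ϖ = WithZero.exp (-1 : ℤ) →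
      ∃ c ∈ 𝒪[v.adicCompletion K], ψ.adicComponent v (ϖ⁻¹ * c) ≠ 1)
    (hq : Nat.card 𝓀[v.adicCompletion K] = v.residueCard) :
    ∃ (ϖ : (v.adicCompletion K)ˣ) (hϖ : Valued.v (ϖ : v.adicCompletion K) = WithZero.exp (-1 : ℤ)),
      ∀ {g' : GL (Fin n) (AdeleRing (𝓞 K) K)},
        Matrix.GeneralLinearGroup.map (AdelicGroupData.adeleEval K v) g' = 1 →
        (∀ {mu : Fin n → ℕ}, Antitone mu →
          whittakerCoeff ν 𝓕 ψ
              (invQuot (AdelicGroupData.gl n K) (smoothedForm η (f : (AdelicGroupData.gl n K).L2 μ)))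
              (GLn.ofLocal n K v (piPowGL (isUniformizingElement_of_valued_eq K v hϖ).ne_zero mu) * g') =
            (((Real.sqrt (v.residueCard : ℝ) : ℝ) : ℂ)) ^ (-torusExponent mu) * schur x mu *
              whittakerCoeff ν 𝓕 ψ
                (invQuot (AdelicGroupData.gl n K) (smoothedForm η (f : (AdelicGroupData.gl n K).L2 μ)))
                g') ∧
        (∀ {nu : Fin n → ℕ}, ¬ Antitone nu →
          whittakerCoeff ν 𝓕 ψ
              (invQuot (AdelicGroupData.gl n K) (smoothedForm η (f : (AdelicGroupData.gl n K).L2 μ)))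
              (GLn.ofLocal n K v (piPowGL (isUniformizingElement_of_valued_eq K v hϖ).ne_zero nu) * g') =
            0) := by
  obtain ⟨ϖ, hϖ, hT⟩ := sum_invQuot_smoothedForm_mul_ofLocal_rep_eq P hα h𝔫₀ hvS hv hη hηs hηK f hx
  refine ⟨ϖ, hϖ, fun {g'} hg' => ?_⟩
  have hD := isUnramifiedWhittakerDatum_whittakerCoeff_ofLocal h𝓕 hψ (isLeftInvariant_invQuot _ _)
    (fun k hk y => invQuot_smoothedForm_mul_ofLocal h𝔫₀ hv hηK _ hk y)
    (isUniformizingElement_of_valued_eq K v hϖ) hT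
    (integrableOn_whittakerIntegrand_of_continuous h𝓕c hψ.continuous
      (continuous_invQuot_smoothedForm hη hηs _)) hg'
  have hs : (((Real.sqrt (v.residueCard : ℝ) : ℝ) : ℂ)) ≠ 0 := by
    rw [Complex.ofReal_ne_zero, Real.sqrt_ne_zero']
    exact_mod_cast zero_lt_one.trans v.one_lt_residueCard
  have hq' : ((Nat.card 𝓀[v.adicCompletion K] : ℕ) : ℂ) =
      (((Real.sqrt (v.residueCard : ℝ) : ℝ) : ℂ)) ^ 2 := by
    rw [hq, ← Complex.ofReal_pow, Real.sq_sqrt (Nat.cast_nonneg _), Complex.ofReal_natCast]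
  obtain ⟨c, hc, hcne⟩ := hψv' ϖ hϖ
  refine ⟨fun hmu => ?_, fun hnu => ?_⟩
  · have h := apply_piPowGL_eq_schur_mul hψv ⟨c, hc, hcne⟩ hD hs hq' hmu
    simpa only [map_one, one_mul] using h
  · exact apply_piPowGL_eq_zero_of_not_antitone
      (W := fun y => whittakerCoeff ν 𝓕 ψ (invQuot (AdelicGroupData.gl n K)
        (smoothedForm η (f : (AdelicGroupData.gl n K).L2 μ))) (GLn.ofLocal n K v y * g'))
      (isUniformizingElement_of_valued_eq K v hϖ) ⟨c, hc, hcne⟩ hD.equivariant hD.spherical hnu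

end Uniform

/-! ### Stripping the `v`-component -/

section Strip

variable {n : ℕ} {K : Type} [Field K] [NumberField K] (v : HeightOneSpectrum (𝓞 K))

/-- `g^{(v)} = g · ι_v(g_v)⁻¹`: the element of `GL_n(𝔸_K)` with the same components as `g` except
`1` at `v`. [folklore] -/
def GLn.stripAt (g : GL (Fin n) (AdeleRing (𝓞 K) K)) : GL (Fin n) (AdeleRing (𝓞 K) K) :=
  g * (GLn.ofLocal n K v (Matrix.GeneralLinearGroup.map (AdelicGroupData.adeleEval K v) g))⁻¹

variable {v}

/-- `g^{(v)} ι_v(g_v) = g`. [folklore] -/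
theorem GLn.stripAt_mul_ofLocal (g : GL (Fin n) (AdeleRing (𝓞 K) K)) :
    GLn.stripAt v g * GLn.ofLocal n K v (Matrix.GeneralLinearGroup.map (AdelicGroupData.adeleEval K v) g) = g :=
  inv_mul_cancel_right _ _

/-- `(g^{(v)})_v = 1`. [folklore] -/
theorem GLn.map_adeleEval_stripAt (g : GL (Fin n) (AdeleRing (𝓞 K) K)) :
    Matrix.GeneralLinearGroup.map (AdelicGroupData.adeleEval K v) (GLn.stripAt v g) = 1 := by
  rw [GLn.stripAt, map_mul, map_inv]
  have : Matrix.GeneralLinearGroup.map (AdelicGroupData.adeleEval K v)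
      (GLn.ofLocal n K v (Matrix.GeneralLinearGroup.map (AdelicGroupData.adeleEval K v) g)) =
      Matrix.GeneralLinearGroup.map (AdelicGroupData.adeleEval K v) g := GLn.toLocal_ofLocal _
  rw [this, mul_inv_cancel]

/-- **Peeling one place.** Let `W : GL_n(𝔸_K) → ℂ` be right invariant under `ι_v(GL_n(𝒪_v))` and
satisfy `W(ι_v(t) g') = c · W(g')` whenever `g'_v = 1`. Then `W(ι_v(t) X) = c · W(X)` for every `X`
with `X_v ∈ GL_n(𝒪_v)`: `X = X^{(v)} ι_v(X_v)` and `ι_v(X_v)` is absorbed on both sides. [folklore] -/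
theorem apply_ofLocal_mul_eq_of_map_adeleEval_mem_glInt {W : GL (Fin n) (AdeleRing (𝓞 K) K) → ℂ}
    {t : GL (Fin n) (v.adicCompletion K)} {c : ℂ}
    (hW : ∀ g' : GL (Fin n) (AdeleRing (𝓞 K) K),
      Matrix.GeneralLinearGroup.map (AdelicGroupData.adeleEval K v) g' = 1 → W (GLn.ofLocal n K v t * g') = c * W g')
    (hWK : ∀ k ∈ glInt n (v.adicCompletion K), ∀ y, W (y * GLn.ofLocal n K v k) = W y)
    {X : GL (Fin n) (AdeleRing (𝓞 K) K)}
    (hX : Matrix.GeneralLinearGroup.map (AdelicGroupData.adeleEval K v) X ∈ glInt n (v.adicCompletion K)) :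
    W (GLn.ofLocal n K v t * X) = c * W X := by
  have h1 : W (GLn.ofLocal n K v t * X) = W (GLn.ofLocal n K v t * GLn.stripAt v X) := by
    conv_lhs => rw [← GLn.stripAt_mul_ofLocal (v := v) X, ← mul_assoc]
    exact hWK _ hX _
  have h2 : W X = W (GLn.stripAt v X) := by
    conv_lhs => rw [← GLn.stripAt_mul_ofLocal (v := v) X]
    exact hWK _ hX _
  rw [h1, h2]
  exact hW _ (GLn.map_adeleEval_stripAt X)

end Strip

/-! ### Local ideles and the torus of `GL₂` -/

section LocalIdele

variable {K : Type} [Field K] [NumberField K] {v : HeightOneSpectrum (𝓞 K)}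

/-- `heckeDiagEntry 2 K v x 1 = ![localUnits x, 1]` (`GaloisRepresentations.localUnits`, the local
idele `x ↦ (x at v, 1 elsewhere)` of `HeckeCharacter`). [folklore] -/
theorem heckeDiagEntry_two_one (x : (v.adicCompletion K)ˣ) :
    heckeDiagEntry 2 K v x 1 = ![GaloisRepresentations.localUnits v x, 1] := by
  funext k
  unfold heckeDiagEntry
  fin_cases k
  · rfl
  · rfl

/-- **`d(localUnits x, 1) = ι_v(d(x, 1))`**: the torus direction at `v`. [folklore] -/
theorem diagGL2_localUnits_one (x : (v.adicCompletion K)ˣ) :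
    diagGL2 (GaloisRepresentations.localUnits v x) 1 = GLn.ofLocal 2 K v (diagGL2 x 1) := by
  have h1 : diagGL2 (GaloisRepresentations.localUnits v x) 1 = heckeDiagAt 2 K v x 1 := by
    rw [heckeDiagAt_eq_glDiagonal, heckeDiagEntry_two_one]; rfl
  have h2 : heckeDiag 2 x 1 = diagGL2 x 1 := by
    refine Units.ext ?_
    rw [coe_heckeDiag, coe_diagGL2]
    ext i j
    fin_cases i <;> fin_cases j <;> simp
  rw [h1, heckeDiagAt_eq_ofLocal, h2]

/-- `ϖ^{(m, 0)} = d(ϖ^m, 1)` in `GL₂(K_v)`. [folklore] -/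
theorem piPowGL_vecCons (ϖ : (v.adicCompletion K)ˣ) (m : ℕ) :
    piPowGL (ϖ.ne_zero) ![m, 0] = diagGL2 (ϖ ^ m) 1 := by
  refine Units.ext ?_
  rw [coe_piPowGL, coe_diagGL2, Echelon.piPow]
  ext i j
  fin_cases i <;> fin_cases j <;> simp [Units.val_pow_eq_pow_val]

/-- `(m, 0)` is antitone. [folklore] -/
theorem antitone_vecCons_zero (m : ℕ) : Antitone (![m, 0] : Fin 2 → ℕ) := by
  intro i j hij
  fin_cases i <;> fin_cases j
  · exact le_rfl
  · simp
  · exact absurd hij (by decide)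
  · exact le_rfl

/-- `b((m, 0)) = m` for `GL₂`. [folklore] -/
theorem torusExponent_vecCons_zero (m : ℕ) : torusExponent (![m, 0] : Fin 2 → ℕ) = m := by
  simp [torusExponent, Fin.sum_univ_two]

/-- The `v`-component of the local idele is `x` (as a unit; `localUnits_snd_apply_self`). [folklore] -/
theorem map_adeleEval_localUnits (x : (v.adicCompletion K)ˣ) :
    Units.map (AdelicGroupData.adeleEval K v : AdeleRing (𝓞 K) K →* v.adicCompletion K)
      (GaloisRepresentations.localUnits v x) = x :=
  Units.ext (GaloisRepresentations.localUnits_snd_apply_self v x)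

/-- The `w`-component of the local idele at `v ≠ w` is `1` (as a unit;
`finiteAdeleSingle_apply_of_ne`). [folklore] -/
theorem map_adeleEval_localUnits_of_ne {w : HeightOneSpectrum (𝓞 K)} (h : w ≠ v) (x : (v.adicCompletion K)ˣ) :
    Units.map (AdelicGroupData.adeleEval K w : AdeleRing (𝓞 K) K →* w.adicCompletion K)
      (GaloisRepresentations.localUnits v x) = 1 :=
  Units.ext (GaloisRepresentations.finiteAdeleSingle_apply_of_ne _ h)

/-- `v`-components of torus elements: `(d(z, a))_v = d(z_v, a_v)`. [folklore] -/
theorem map_adeleEval_diagGL2 (w : HeightOneSpectrum (𝓞 K)) (z a : (AdeleRing (𝓞 K) K)ˣ) :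
    Matrix.GeneralLinearGroup.map (AdelicGroupData.adeleEval K w) (diagGL2 z a) =
      diagGL2 (Units.map (AdelicGroupData.adeleEval K w : AdeleRing (𝓞 K) K →* w.adicCompletion K) z)
        (Units.map (AdelicGroupData.adeleEval K w : AdeleRing (𝓞 K) K →* w.adicCompletion K) a) :=
  map_diagGL2 _ z a

end LocalIdele

/-! ### The factorisation along an idele -/

section Factorization

variable {K : Type} [Field K] [NumberField K]

/-- **The torus idele of a profile**: `π_m^T = ∏_{v ∈ T} (ϖ_v^{m_v} at v)` (a product of local
ideles `GaloisRepresentations.localUnits`). [folklore] -/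
def profileIdele (ϖ : (v : HeightOneSpectrum (𝓞 K)) → (v.adicCompletion K)ˣ) (m : HeightOneSpectrum (𝓞 K) → ℕ)
    (T : Finset (HeightOneSpectrum (𝓞 K))) : (AdeleRing (𝓞 K) K)ˣ :=
  ∏ v ∈ T, GaloisRepresentations.localUnits v (ϖ v ^ m v)

/-- The `w`-component of `π_m^T` is `1` off `T`. [folklore] -/
theorem map_adeleEval_profileIdele_of_notMem (ϖ : (v : HeightOneSpectrum (𝓞 K)) → (v.adicCompletion K)ˣ)
    (m : HeightOneSpectrum (𝓞 K) → ℕ) {T : Finset (HeightOneSpectrum (𝓞 K))} {w : HeightOneSpectrum (𝓞 K)}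
    (hw : w ∉ T) :
    Units.map (AdelicGroupData.adeleEval K w : AdeleRing (𝓞 K) K →* w.adicCompletion K) (profileIdele ϖ m T) = 1 := by
  rw [profileIdele, map_prod]
  refine Finset.prod_eq_one fun v hv => ?_
  exact map_adeleEval_localUnits_of_ne (fun hwv => hw (by rw [hwv]; exact hv)) _

/-- **Factorisation of a Whittaker coefficient along the unramified torus directions.** Let
`W : GL₂(𝔸_K) → ℂ` and let `T` be a finite set of finite places; suppose that for every `v ∈ T`,
`W` is right invariant under `ι_v(GL₂(𝒪_v))` and satisfies Shintani's relation
`W(ι_v(d(ϖ_v^m, 1)) g') = c_v(m) W(g')` for all `g'` with `g'_v = 1` and all `m`. Then for every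
idele `z`, every `h ∈ GL₂(𝔸_K)` with `(d(z,1) h)_v ∈ GL₂(𝒪_v)` for all `v ∈ T`, and every profile
`m`: `W(d(π_m^T z, 1) h) = (∏_{v ∈ T} c_v(m_v)) · W(d(z,1) h)` — induction on `T`, peeling one place
at a time (`apply_ofLocal_mul_eq_of_map_adeleEval_mem_glInt`). [folklore] -/
theorem whittaker_factorization_profileIdele {W : GL (Fin 2) (AdeleRing (𝓞 K) K) → ℂ}
    (ϖ : (v : HeightOneSpectrum (𝓞 K)) → (v.adicCompletion K)ˣ)
    (c : HeightOneSpectrum (𝓞 K) → ℕ → ℂ) (T : Finset (HeightOneSpectrum (𝓞 K)))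
    (hSh : ∀ v ∈ T, ∀ g' : GL (Fin 2) (AdeleRing (𝓞 K) K),
      Matrix.GeneralLinearGroup.map (AdelicGroupData.adeleEval K v) g' = 1 →
        ∀ m : ℕ, W (GLn.ofLocal 2 K v (diagGL2 (ϖ v ^ m) 1) * g') = c v m * W g')
    (hInv : ∀ v ∈ T, ∀ k ∈ glInt 2 (v.adicCompletion K), ∀ y, W (y * GLn.ofLocal 2 K v k) = W y)
    (m : HeightOneSpectrum (𝓞 K) → ℕ) (z : (AdeleRing (𝓞 K) K)ˣ) (h : GL (Fin 2) (AdeleRing (𝓞 K) K))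
    (hzh : ∀ v ∈ T, Matrix.GeneralLinearGroup.map (AdelicGroupData.adeleEval K v) (diagGL2 z 1 * h) ∈
      glInt 2 (v.adicCompletion K)) :
    W (diagGL2 (profileIdele ϖ m T * z) 1 * h) = (∏ v ∈ T, c v (m v)) * W (diagGL2 z 1 * h) := by
  classical
  induction T using Finset.induction_on with
  | empty =>
    rw [profileIdele, Finset.prod_empty, Finset.prod_empty, one_mul, one_mul]
  | @insert v T hvT ih =>
    have hSh' : ∀ w ∈ T, ∀ g' : GL (Fin 2) (AdeleRing (𝓞 K) K),
        Matrix.GeneralLinearGroup.map (AdelicGroupData.adeleEval K w) g' = 1 →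
          ∀ m : ℕ, W (GLn.ofLocal 2 K w (diagGL2 (ϖ w ^ m) 1) * g') = c w m * W g' :=
      fun w hw => hSh w (Finset.mem_insert_of_mem hw)
    have hInv' : ∀ w ∈ T, ∀ k ∈ glInt 2 (w.adicCompletion K), ∀ y, W (y * GLn.ofLocal 2 K w k) = W y :=
      fun w hw => hInv w (Finset.mem_insert_of_mem hw)
    have hzh' : ∀ w ∈ T, Matrix.GeneralLinearGroup.map (AdelicGroupData.adeleEval K w) (diagGL2 z 1 * h) ∈
        glInt 2 (w.adicCompletion K) := fun w hw => hzh w (Finset.mem_insert_of_mem hw)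
    -- split off the place `v`
    set X : GL (Fin 2) (AdeleRing (𝓞 K) K) := diagGL2 (profileIdele ϖ m T * z) 1 * h with hX
    have hsplit : diagGL2 (profileIdele ϖ m (insert v T) * z) 1 * h =
        GLn.ofLocal 2 K v (diagGL2 (ϖ v ^ m v) 1) * X := by
      rw [← diagGL2_localUnits_one, hX, ← mul_assoc, ← diagGL2_mul, one_mul]
      simp only [profileIdele, Finset.prod_insert hvT, mul_assoc]
    have hXv : Matrix.GeneralLinearGroup.map (AdelicGroupData.adeleEval K v) X ∈ glInt 2 (v.adicCompletion K) := by
      have hdecomp : X = diagGL2 (profileIdele ϖ m T) 1 * (diagGL2 z 1 * h) := by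
        rw [hX, ← mul_assoc, ← diagGL2_mul, one_mul]
      rw [hdecomp, map_mul, map_adeleEval_diagGL2, map_adeleEval_profileIdele_of_notMem ϖ m hvT, map_one,
        diagGL2_one, one_mul]
      exact hzh v (Finset.mem_insert_self v T)
    rw [hsplit, apply_ofLocal_mul_eq_of_map_adeleEval_mem_glInt
      (fun g' hg' => hSh v (Finset.mem_insert_self v T) g' hg' (m v))
      (hInv v (Finset.mem_insert_self v T)) hXv, ih hSh' hInv' hzh', Finset.prod_insert hvT, mul_assoc]

end Factorization

end Literature.NumberTheory.Automorphic
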